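import Summits.AtomisticToContinuum.Crystallization.Theorems.FreeSplittingCertificatesStrictSplittingRuleP1ReadBridge
import Summits.AtomisticToContinuum.Crystallization.Theorems.FreeSplittingCertificatesStrictSplittingRuleP1CubeRec
import Summits.AtomisticToContinuum.Crystallization.Theorems.FreeSplittingCertificatesStrictSplittingRuleHcpFamilyMinLocalised

/-!
# `StrictSplittingRule` (stmt-AtomisticToContinuum-12560): ASSEMBLY GLUE I — ratio box from `HcpFamilyMin`, stretches of a skew co-rotation, additivity of the transfer series, and the exact NEAR/FAR SPLIT of the readout-form demand (P1 interpolant object, part 44)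

Route `FreeSplittingCertificates`, crux r3 `StrictSplittingRule` (H12⋆ = `stub_coreJointCoercive`), unit b2b-freesplit-B gen 32.
VALUE = four of the glue items of the kernel assembly map (HOME FAR-LEMMA-SPEC §23 (b): G3, G4, G2, G5), each a bookkeeping fact the composition
`CoreJointSiteIneq ⇐ near certificate + far chain` consumes:
* **`ratioBox_of_hcpFamilyMin`** (G3) — the `HcpFamilyMin` enclosure (`|a − 0.97129| ≤ 10⁻⁴`, `|h − 0.79294| ≤ 10⁻⁴`) lies in the hcp ratio box
  `81619/100000·a ≤ h ≤ 81657/100000·a` of the sharp element lemmas / `farReceipts_le_tsum_table`;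
* **`p1Str_eq_inner_of_skew`** (G4) — for a SKEW co-rotation `W` (`⟪Wz,z⟫ = 0`) acting by the matrix `A`, the stretch of the far-ledger field is the lattice stretch of `u`:
  `p1Str a h u b₀ A q q' = ⟪y_{q'} − y_q, u_{q'} − u_q⟫` (the rotation drops out of every stretch — so the receipts series of part 19 IS the `g_q(s)²` series of part 39);
* **`coreJoint_transfer_add`** (G2) — the antisymmetrised transfer series of `CoreJointSiteIneq` is additive in the tables `(M, N)` (near table + far diagonal table);
* **`coreJoint_readoutForm_split`** (G5) — for ANY far share `0 ≤ w(q,s) ≤ [s∈Y₁][q≠p]·|β(b_q)(p−q)(s)|/2` (rule v31's capacity-defined share, shed set zero) the readout-form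
  series splits EXACTLY into a summable NEAR part with coefficients `½β − w` and the summable FAR leg-load series `Σ'_{(q,s)} w(q,s)·‖u(q+s) − u q − W(y_{q+s}−y_q)‖²`.
NOT a proof of H12⋆, NOT summit progress.  [folklore]
-/

noncomputable section

open Set Function
open scoped BigOperators

namespace Summit.AtomisticToContinuum.Crystallization.Theorems.StrictSplittingRuleBirth

open Literature.MathematicalPhysics.StatisticalMechanics
open Summit.AtomisticToContinuum.Crystallization.Theorems.PalmUnimodularRigidity.LayeredLawsSelectHcp
open Summit.AtomisticToContinuum.Crystallization.Theorems.PhononStabilityCWC.Cert (inner_fin3)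

/-! ## G3: the family-minimiser box lies in the hcp ratio box -/

/-- **The `HcpFamilyMin` enclosure lies in the ratio box** of the sharp element lemmas: `81619/100000·a ≤ h ≤ 81657/100000·a`.
NOT a proof of H12⋆, NOT summit progress. -/
theorem ratioBox_of_hcpFamilyMin {a h : ℝ} (ha : 0 < a) (hh : 0 < h) (hfam : HcpFamilyMin a h) :
    81619 / 100000 * a ≤ h ∧ h ≤ 81657 / 100000 * a := by
  obtain ⟨hA, hH⟩ := hcpFamilyMin_enclosure ha hh hfam
  rw [abs_sub_le_iff] at hA hH
  obtain ⟨hA₁, hA₂⟩ := hA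
  obtain ⟨hH₁, hH₂⟩ := hH
  constructor <;> nlinarith

/-! ## G4: stretches do not see a skew co-rotation -/

/-- **Stretches of the far-ledger field of a skew co-rotation**: if `W` is skew (`⟪W z, z⟫ = 0`) and acts by the matrix `A`, then for every `b₀`
`p1Str a h u b₀ A q q' = ⟪y_{q'} − y_q, u_{q'} − u_q⟫`.  NOT a proof of H12⋆, NOT summit progress. -/
theorem p1Str_eq_inner_of_skew {a h : ℝ} (ha : a ≠ 0) (hh : h ≠ 0) (u : ℤ × ℤ × ℤ → EuclideanSpace ℝ (Fin 3))
    (W : EuclideanSpace ℝ (Fin 3) →ₗ[ℝ] EuclideanSpace ℝ (Fin 3)) (hW : ∀ z : EuclideanSpace ℝ (Fin 3), inner ℝ (W z) z = 0)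
    (A : Fin 3 → Fin 3 → ℝ) (hA : ∀ (y : EuclideanSpace ℝ (Fin 3)) (k : Fin 3), W y k = y 0 * A 0 k + y 1 * A 1 k + y 2 * A 2 k)
    (b₀ : Fin 3 → ℝ) (q q' : ℤ × ℤ × ℤ) :
    p1Str a h (fun n k => u n k) b₀ A q q' = inner ℝ (hcpSite a h q' - hcpSite a h q) (u q' - u q) := by
  have h0 := hW (hcpSite a h q' - hcpSite a h q)
  rw [inner_fin3, hA, hA, hA, PiLp.sub_apply, PiLp.sub_apply, PiLp.sub_apply] at h0
  unfold p1Str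
  rw [inner_fin3, inner_fin3]
  simp only [PiLp.sub_apply, p1DispSite_apply ha hh]
  linear_combination -h0

/-! ## G2: additivity of the transfer series in the tables -/

/-- **The antisymmetrised transfer series is additive in `(M, N)`**: if the families of `(M₁,N₁)` and `(M₂,N₂)` are summable, so is that of
`(M₁+M₂, N₁+N₂)`, and its sum is the sum of the two.  NOT a proof of H12⋆, NOT summit progress. -/
theorem coreJoint_transfer_add {a h : ℝ} (Y : Finset (ℤ × ℤ × ℤ))
    (M₁ N₁ M₂ N₂ M N : Bool → (ℤ × ℤ × ℤ) → (ℤ × ℤ × ℤ) → (ℤ × ℤ × ℤ) → ℝ)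
    (hM : ∀ b e s s', M b e s s' = M₁ b e s s' + M₂ b e s s') (hN : ∀ b e s s', N b e s s' = N₁ b e s s' + N₂ b e s s')
    (u : ℤ × ℤ × ℤ → EuclideanSpace ℝ (Fin 3)) (p : ℤ × ℤ × ℤ)
    (h₁ : Summable fun q : ℤ × ℤ × ℤ => if q = p then (0 : ℝ) else
        ∑ s ∈ Y, ∑ s' ∈ Y,
          (M₁ (decide (Even p.1)) (q - p) s s' *
              (inner ℝ (hcpSite a h (p + s) - hcpSite a h p) (u (p + s) - u p) *
                inner ℝ (hcpSite a h (p + s') - hcpSite a h p) (u (p + s') - u p)) -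
            M₁ (decide (Even q.1)) (p - q) s s' *
              (inner ℝ (hcpSite a h (q + s) - hcpSite a h q) (u (q + s) - u q) *
                inner ℝ (hcpSite a h (q + s') - hcpSite a h q) (u (q + s') - u q)) +
            (N₁ (decide (Even p.1)) (q - p) s s' - N₁ (decide (Even q.1)) (p - q) s' s) *
              (inner ℝ (hcpSite a h (p + s) - hcpSite a h p) (u (p + s) - u p) *
                inner ℝ (hcpSite a h (q + s') - hcpSite a h q) (u (q + s') - u q))))
    (h₂ : Summable fun q : ℤ × ℤ × ℤ => if q = p then (0 : ℝ) else
        ∑ s ∈ Y, ∑ s' ∈ Y,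
          (M₂ (decide (Even p.1)) (q - p) s s' *
              (inner ℝ (hcpSite a h (p + s) - hcpSite a h p) (u (p + s) - u p) *
                inner ℝ (hcpSite a h (p + s') - hcpSite a h p) (u (p + s') - u p)) -
            M₂ (decide (Even q.1)) (p - q) s s' *
              (inner ℝ (hcpSite a h (q + s) - hcpSite a h q) (u (q + s) - u q) *
                inner ℝ (hcpSite a h (q + s') - hcpSite a h q) (u (q + s') - u q)) +
            (N₂ (decide (Even p.1)) (q - p) s s' - N₂ (decide (Even q.1)) (p - q) s' s) *
              (inner ℝ (hcpSite a h (p + s) - hcpSite a h p) (u (p + s) - u p) *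
                inner ℝ (hcpSite a h (q + s') - hcpSite a h q) (u (q + s') - u q)))) :
    Summable (fun q : ℤ × ℤ × ℤ => if q = p then (0 : ℝ) else
        ∑ s ∈ Y, ∑ s' ∈ Y,
          (M (decide (Even p.1)) (q - p) s s' *
              (inner ℝ (hcpSite a h (p + s) - hcpSite a h p) (u (p + s) - u p) *
                inner ℝ (hcpSite a h (p + s') - hcpSite a h p) (u (p + s') - u p)) -
            M (decide (Even q.1)) (p - q) s s' *
              (inner ℝ (hcpSite a h (q + s) - hcpSite a h q) (u (q + s) - u q) *
                inner ℝ (hcpSite a h (q + s') - hcpSite a h q) (u (q + s') - u q)) +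
            (N (decide (Even p.1)) (q - p) s s' - N (decide (Even q.1)) (p - q) s' s) *
              (inner ℝ (hcpSite a h (p + s) - hcpSite a h p) (u (p + s) - u p) *
                inner ℝ (hcpSite a h (q + s') - hcpSite a h q) (u (q + s') - u q)))) ∧
    (∑' q : ℤ × ℤ × ℤ, (if q = p then (0 : ℝ) else
        ∑ s ∈ Y, ∑ s' ∈ Y,
          (M (decide (Even p.1)) (q - p) s s' *
              (inner ℝ (hcpSite a h (p + s) - hcpSite a h p) (u (p + s) - u p) *
                inner ℝ (hcpSite a h (p + s') - hcpSite a h p) (u (p + s') - u p)) -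
            M (decide (Even q.1)) (p - q) s s' *
              (inner ℝ (hcpSite a h (q + s) - hcpSite a h q) (u (q + s) - u q) *
                inner ℝ (hcpSite a h (q + s') - hcpSite a h q) (u (q + s') - u q)) +
            (N (decide (Even p.1)) (q - p) s s' - N (decide (Even q.1)) (p - q) s' s) *
              (inner ℝ (hcpSite a h (p + s) - hcpSite a h p) (u (p + s) - u p) *
                inner ℝ (hcpSite a h (q + s') - hcpSite a h q) (u (q + s') - u q))))) =
    (∑' q : ℤ × ℤ × ℤ, (if q = p then (0 : ℝ) else
        ∑ s ∈ Y, ∑ s' ∈ Y,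
          (M₁ (decide (Even p.1)) (q - p) s s' *
              (inner ℝ (hcpSite a h (p + s) - hcpSite a h p) (u (p + s) - u p) *
                inner ℝ (hcpSite a h (p + s') - hcpSite a h p) (u (p + s') - u p)) -
            M₁ (decide (Even q.1)) (p - q) s s' *
              (inner ℝ (hcpSite a h (q + s) - hcpSite a h q) (u (q + s) - u q) *
                inner ℝ (hcpSite a h (q + s') - hcpSite a h q) (u (q + s') - u q)) +
            (N₁ (decide (Even p.1)) (q - p) s s' - N₁ (decide (Even q.1)) (p - q) s' s) *
              (inner ℝ (hcpSite a h (p + s) - hcpSite a h p) (u (p + s) - u p) *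
                inner ℝ (hcpSite a h (q + s') - hcpSite a h q) (u (q + s') - u q))))) +
    (∑' q : ℤ × ℤ × ℤ, (if q = p then (0 : ℝ) else
        ∑ s ∈ Y, ∑ s' ∈ Y,
          (M₂ (decide (Even p.1)) (q - p) s s' *
              (inner ℝ (hcpSite a h (p + s) - hcpSite a h p) (u (p + s) - u p) *
                inner ℝ (hcpSite a h (p + s') - hcpSite a h p) (u (p + s') - u p)) -
            M₂ (decide (Even q.1)) (p - q) s s' *
              (inner ℝ (hcpSite a h (q + s) - hcpSite a h q) (u (q + s) - u q) *
                inner ℝ (hcpSite a h (q + s') - hcpSite a h q) (u (q + s') - u q)) +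
            (N₂ (decide (Even p.1)) (q - p) s s' - N₂ (decide (Even q.1)) (p - q) s' s) *
              (inner ℝ (hcpSite a h (p + s) - hcpSite a h p) (u (p + s) - u p) *
                inner ℝ (hcpSite a h (q + s') - hcpSite a h q) (u (q + s') - u q))))) := by
  set g : (ℤ × ℤ × ℤ) → (ℤ × ℤ × ℤ) → ℝ := fun q s => inner ℝ (hcpSite a h (q + s) - hcpSite a h q) (u (q + s) - u q) with hg
  -- the generic term as a function of the tables
  have hterm : ∀ q : ℤ × ℤ × ℤ, (if q = p then (0 : ℝ) else
        ∑ s ∈ Y, ∑ s' ∈ Y,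
          (M (decide (Even p.1)) (q - p) s s' * (g p s * g p s') - M (decide (Even q.1)) (p - q) s s' * (g q s * g q s') +
            (N (decide (Even p.1)) (q - p) s s' - N (decide (Even q.1)) (p - q) s' s) * (g p s * g q s'))) =
      (if q = p then (0 : ℝ) else
        ∑ s ∈ Y, ∑ s' ∈ Y,
          (M₁ (decide (Even p.1)) (q - p) s s' * (g p s * g p s') - M₁ (decide (Even q.1)) (p - q) s s' * (g q s * g q s') +
            (N₁ (decide (Even p.1)) (q - p) s s' - N₁ (decide (Even q.1)) (p - q) s' s) * (g p s * g q s'))) +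
      (if q = p then (0 : ℝ) else
        ∑ s ∈ Y, ∑ s' ∈ Y,
          (M₂ (decide (Even p.1)) (q - p) s s' * (g p s * g p s') - M₂ (decide (Even q.1)) (p - q) s s' * (g q s * g q s') +
            (N₂ (decide (Even p.1)) (q - p) s s' - N₂ (decide (Even q.1)) (p - q) s' s) * (g p s * g q s'))) := by
    intro q
    split_ifs with hq
    · ring
    · rw [← Finset.sum_add_distrib]
      refine Finset.sum_congr rfl fun s _ => ?_
      rw [← Finset.sum_add_distrib]
      refine Finset.sum_congr rfl fun s' _ => ?_
      rw [hM, hM, hN, hN]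
      ring
  have hfun : (fun q : ℤ × ℤ × ℤ => if q = p then (0 : ℝ) else
        ∑ s ∈ Y, ∑ s' ∈ Y,
          (M (decide (Even p.1)) (q - p) s s' * (g p s * g p s') - M (decide (Even q.1)) (p - q) s s' * (g q s * g q s') +
            (N (decide (Even p.1)) (q - p) s s' - N (decide (Even q.1)) (p - q) s' s) * (g p s * g q s'))) =
      fun q => (if q = p then (0 : ℝ) else
        ∑ s ∈ Y, ∑ s' ∈ Y,
          (M₁ (decide (Even p.1)) (q - p) s s' * (g p s * g p s') - M₁ (decide (Even q.1)) (p - q) s s' * (g q s * g q s') +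
            (N₁ (decide (Even p.1)) (q - p) s s' - N₁ (decide (Even q.1)) (p - q) s' s) * (g p s * g q s'))) +
      (if q = p then (0 : ℝ) else
        ∑ s ∈ Y, ∑ s' ∈ Y,
          (M₂ (decide (Even p.1)) (q - p) s s' * (g p s * g p s') - M₂ (decide (Even q.1)) (p - q) s s' * (g q s * g q s') +
            (N₂ (decide (Even p.1)) (q - p) s s' - N₂ (decide (Even q.1)) (p - q) s' s) * (g p s * g q s'))) := funext hterm
  refine ⟨?_, ?_⟩
  · rw [hfun]; exact h₁.add h₂
  · rw [hfun]; exact h₁.tsum_add h₂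

/-! ## G5: the exact near/far split of the readout-form demand -/

/-- **NEAR/FAR SPLIT OF THE READOUT-FORM DEMAND.**  For `β` with the decay of `CoreJointCoercive`, a finitely supported `u`, a site `p`, a linear `W`,
and ANY far share `w : ℤ³ × ℤ³ → ℝ` with `0 ≤ w(q,s) ≤ [s ∈ Y₁][q ≠ p]·|β(b_q)(p−q)(s)|/2`: writing `R(q,s) = ‖u(q+s) − u q − W(y_{q+s} − y_q)‖²`,
(i) the far leg-load family `(q,s) ↦ w(q,s)·R(q,s)` is summable, (ii) the near family `q ↦ [q≠p]·Σ_{s∈Y₁}(β(b_q)(p−q)(s)/2 − w(q,s))·R(q,s)` is summable, and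
(iii) `Σ'_q [q≠p]Σ_{s∈Y₁} β(b_q)(p−q)(s)·½R(q,s) = (Σ' near) + Σ'_{(q,s)} w(q,s)·R(q,s)`.  NOT a proof of H12⋆, NOT summit progress. -/
theorem coreJoint_readoutForm_split {a h C : ℝ} (ha : 0 < a) (hh : 0 < h) (Y₁ : Finset (ℤ × ℤ × ℤ))
    (β : Bool → (ℤ × ℤ × ℤ) → (ℤ × ℤ × ℤ) → ℝ)
    (hβ : ∀ p q : ℤ × ℤ × ℤ, ∀ s, |β (decide (Even p.1)) (q - p) s| ≤ C * ((1 + ‖hcpSite a h q - hcpSite a h p‖)⁻¹) ^ 6)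
    (u : ℤ × ℤ × ℤ → EuclideanSpace ℝ (Fin 3)) (hu : (support u).Finite) (p : ℤ × ℤ × ℤ)
    (W : EuclideanSpace ℝ (Fin 3) →ₗ[ℝ] EuclideanSpace ℝ (Fin 3))
    (w : (ℤ × ℤ × ℤ) × (ℤ × ℤ × ℤ) → ℝ) (hw0 : ∀ e, 0 ≤ w e)
    (hwle : ∀ e, w e ≤ if e.2 ∈ Y₁ ∧ e.1 ≠ p then |β (decide (Even e.1.1)) (p - e.1) e.2| / 2 else 0) :
    Summable (fun e : (ℤ × ℤ × ℤ) × (ℤ × ℤ × ℤ) =>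
      w e * ‖u (e.1 + e.2) - u e.1 - W (hcpSite a h (e.1 + e.2) - hcpSite a h e.1)‖ ^ 2) ∧
    Summable (fun q : ℤ × ℤ × ℤ => if q = p then (0 : ℝ) else
      ∑ s ∈ Y₁, (β (decide (Even q.1)) (p - q) s / 2 - w (q, s)) * ‖u (q + s) - u q - W (hcpSite a h (q + s) - hcpSite a h q)‖ ^ 2) ∧
    (∑' q : ℤ × ℤ × ℤ, if q = p then (0 : ℝ) else
      ∑ s ∈ Y₁, β (decide (Even q.1)) (p - q) s * (1 / 2 * ‖u (q + s) - u q - W (hcpSite a h (q + s) - hcpSite a h q)‖ ^ 2)) =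
    (∑' q : ℤ × ℤ × ℤ, if q = p then (0 : ℝ) else
      ∑ s ∈ Y₁, (β (decide (Even q.1)) (p - q) s / 2 - w (q, s)) * ‖u (q + s) - u q - W (hcpSite a h (q + s) - hcpSite a h q)‖ ^ 2) +
    ∑' e : (ℤ × ℤ × ℤ) × (ℤ × ℤ × ℤ), w e * ‖u (e.1 + e.2) - u e.1 - W (hcpSite a h (e.1 + e.2) - hcpSite a h e.1)‖ ^ 2 := by
  obtain ⟨A, hA⟩ := exists_p1Matrix W
  obtain ⟨hS1, hS2, -⟩ := coreJoint_readoutForm_le_tsum_legLoad ha hh Y₁ β hβ u hu p W A hA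
  obtain ⟨R, hRdef⟩ : ∃ R : (ℤ × ℤ × ℤ) → (ℤ × ℤ × ℤ) → ℝ,
      R = fun q s => ‖u (q + s) - u q - W (hcpSite a h (q + s) - hcpSite a h q)‖ ^ 2 := ⟨_, rfl⟩
  have hRq : ∀ q s, ‖u (q + s) - u q - W (hcpSite a h (q + s) - hcpSite a h q)‖ ^ 2 = R q s := fun q s => by rw [hRdef]
  simp only [hRq] at hS1 ⊢
  have hR0 : ∀ q s, 0 ≤ R q s := fun q s => by rw [← hRq]; positivity
  have hReq : ∀ q s, R q s = fpSq (fun k => p1DispSite a h (fun n k => u n k) 0 A (q + s) k - p1DispSite a h (fun n k => u n k) 0 A q k) :=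
    fun q s => by rw [← hRq]; exact norm_sq_coreReadout_eq_fpSq ha.ne' hh.ne' u W A hA 0 q s
  -- w vanishes off Y₁ and at the base site p, and is dominated by the |β| loads of part 42
  have hwY : ∀ q s, s ∉ Y₁ → w (q, s) = 0 := fun q s hs =>
    le_antisymm ((hwle (q, s)).trans (by rw [if_neg (fun h => hs h.1)])) (hw0 _)
  have hwp : ∀ s, w (p, s) = 0 := fun s =>
    le_antisymm ((hwle (p, s)).trans (by rw [if_neg (fun h => h.2 rfl)])) (hw0 _)
  have hdom : ∀ e : (ℤ × ℤ × ℤ) × (ℤ × ℤ × ℤ), w e ≤ (if e.2 ∈ Y₁ then |β (decide (Even e.1.1)) (p - e.1) e.2| / 2 else 0) := by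
    intro e
    refine (hwle e).trans ?_
    by_cases hs : e.2 ∈ Y₁
    · by_cases hq : e.1 ≠ p
      · rw [if_pos ⟨hs, hq⟩, if_pos hs]
      · rw [if_neg (fun h => hq h.2), if_pos hs]; positivity
    · rw [if_neg (fun h => hs h.1), if_neg hs]
  -- (i) the far family
  have hfar : Summable (fun e : (ℤ × ℤ × ℤ) × (ℤ × ℤ × ℤ) => w e * R e.1 e.2) := by
    refine Summable.of_nonneg_of_le (fun e => mul_nonneg (hw0 e) (hR0 _ _)) (fun e => ?_) hS2
    calc w e * R e.1 e.2 ≤ (if e.2 ∈ Y₁ then |β (decide (Even e.1.1)) (p - e.1) e.2| / 2 else 0) * R e.1 e.2 :=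
          mul_le_mul_of_nonneg_right (hdom e) (hR0 _ _)
      _ = _ := by rw [hReq]
  -- its row sums
  have hrow : Summable fun q : ℤ × ℤ × ℤ => ∑' s : ℤ × ℤ × ℤ, w (q, s) * R q s := hfar.prod
  have hrow_eq : ∀ q : ℤ × ℤ × ℤ, ∑' s : ℤ × ℤ × ℤ, w (q, s) * R q s = ∑ s ∈ Y₁, w (q, s) * R q s := fun q =>
    tsum_eq_sum (s := Y₁) fun s hs => by rw [hwY q s hs, zero_mul]
  have hrow' : Summable fun q : ℤ × ℤ × ℤ => ∑ s ∈ Y₁, w (q, s) * R q s := hrow.congr hrow_eq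
  -- termwise split
  have hsplit : ∀ q : ℤ × ℤ × ℤ, (if q = p then (0 : ℝ) else ∑ s ∈ Y₁, β (decide (Even q.1)) (p - q) s * (1 / 2 * R q s)) =
      (if q = p then (0 : ℝ) else ∑ s ∈ Y₁, (β (decide (Even q.1)) (p - q) s / 2 - w (q, s)) * R q s) +
        ∑ s ∈ Y₁, w (q, s) * R q s := by
    intro q
    split_ifs with hq
    · rw [hq, zero_add]
      exact (Finset.sum_eq_zero fun s _ => by rw [hwp s, zero_mul]).symm
    · rw [← Finset.sum_add_distrib]
      exact Finset.sum_congr rfl fun s _ => by ring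
  have hfunS : (fun q : ℤ × ℤ × ℤ => if q = p then (0 : ℝ) else ∑ s ∈ Y₁, β (decide (Even q.1)) (p - q) s * (1 / 2 * R q s)) =
      fun q => (if q = p then (0 : ℝ) else ∑ s ∈ Y₁, (β (decide (Even q.1)) (p - q) s / 2 - w (q, s)) * R q s) +
        ∑ s ∈ Y₁, w (q, s) * R q s := funext hsplit
  -- (ii) the near family = original − far rows
  have hnear : Summable fun q : ℤ × ℤ × ℤ => if q = p then (0 : ℝ) else
      ∑ s ∈ Y₁, (β (decide (Even q.1)) (p - q) s / 2 - w (q, s)) * R q s := by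
    refine (hS1.sub hrow').congr fun q => ?_
    rw [hsplit q, add_sub_cancel_right]
  refine ⟨hfar, hnear, ?_⟩
  -- (iii) the sums
  rw [hfunS, hnear.tsum_add hrow', hfar.tsum_prod]
  simp only [hrow_eq]

end Summit.AtomisticToContinuum.Crystallization.Theorems.StrictSplittingRuleBirth

end
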